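import Summits.Parity.GeneralizedHardyLittlewood.Theorems.BeyondDiagonalBeatsQuarter.OffDiagLayersTail
import Summits.Parity.GeneralizedHardyLittlewood.Theorems.BeyondDiagonalBeatsQuarter.OffDiagDyadic
import Summits.Parity.GeneralizedHardyLittlewood.Theorems.BeyondDiagonalBeatsQuarter.OffDiagWeightSmooth
import HarnessLib

/-!
# Route `PrimeLevelFamEdge`, crux K_B (stmt-Parity-20343), line `diagonal_kernel_split` rev 4, plan Ω,
# worker key W-b (ii), part 1 `OffDiagBoxes`: ONE dyadic box of a Kloosterman layer — a UNIFORM per-box bound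
# (card × sup), and the FAR boxes (`2^{i₁+i₂}d₁d₂ ≥ 4q̂²y₀`) are exponentially small in `√y₀`

Ω-d3 (`OffDiagLayersTail.offDiagLayer_eq_sum_divisors`) writes a Petersson layer of `offDiag q l m` as
`Σ_{d₁∣l,d₂∣m} Σ_{k∈ℕ²} s(k)`, `s(k) = w_q(d₁k₁,d₂k₂)·petKloostermanTerm q ((l/d₁)k₁) ((m/d₂)k₂) r`;
Ω-d4 (`OffDiag.tsum_eq_tsum_dyadicBoxes`) cuts `Σ_k s(k) = Σ_{i∈ℕ²} box_i`,
`box_i = Σ_k θ(k₁/2^{i₁})θ(k₂/2^{i₂})·s(k)` (finite sums); Ω-d5 turns each box into its dual sum. Here: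
* §1 `norm_layerSummand_le`: `‖s(k)‖ ≤ (lm)^{3/4}·4πC q^{−1/2}r^{−29/20}·[w_q(n)(n₁n₂)^{3/4}]`, `n = (d₁k₁,d₂k₂)`
  (Weil, as in Ω-d3), and the FAR decay of the AFE weight: `w_q(n)(n₁n₂)^{3/4} ≤ 96e^{−√y₀/2}q̂³·n₁^{−5/4}n₂^{−5/4}`
  once `n₁n₂ ≥ q̂²y₀` (`W(y) ≤ 2·3!·2³·e^{−√y₀/2}y^{−3/2}`, the K_A lemma `cutoffW_le_exp_mul_rpow`);
* §2 **`norm_boxSum_le`**: for any `E ≥ 0` with `w_q(n)(n₁n₂)^{3/4} ≤ E q̂³n₁^{−5/4}n₂^{−5/4}` on the open box,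
  `‖box_i‖ ≤ 64·(lm)^{3/4}·4πC q^{−1/2}r^{−29/20}·E q̂³·(d₁d₂)^{−5/4}·ρ^{i₁}ρ^{i₂}`, `ρ = 2^{−1/4}` (card × sup:
  the box has `≤ 2^{i₁+1}2^{i₂+1}` points, each with `n_j > d_j2^{i_j}/2`); `E = 12` always
  (`norm_boxSum_le_near`), `E = 96e^{−√y₀/2}` on FAR boxes (`norm_boxSum_le_far`).
Part 2 (`OffDiagBoxesNearFar.lean`): the far boxes in total and the NEAR/FAR split with a finite near set.
Absolute-value bookkeeping only; nothing about the heart. Helper (`--supports stmt-Parity-20343`); standard axioms.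
«The programme SEARCHES and TYPES; no claim about Landau–Siegel zeros, Theorems 1–2 of arXiv:2211.02515 or
a repaired Margin232 until a kernel theorem says so.»
-/


noncomputable section

open Finset
open scoped Real Nat

namespace Summit.Parity.GeneralizedHardyLittlewood.Theorems.BeyondDiagonalBeatsQuarter.PeterssonSplit

open Literature.NumberTheory.LFunctions Literature.NumberTheory.LFunctions.KMV2000
open Literature.NumberTheory.LFunctions.KowalskiMichel2000 (petKloostermanTerm)
open Literature.Analysis.Calculus.WhitneyConvex (dyadicBump dyadicBump_nonneg dyadicBump_le_one)
open Summit.Parity.GeneralizedHardyLittlewood.Theorems.PrimeLevelFamEdgeIdeaDeltas.PeterssonLayers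
  (cutoffW_le_exp_mul_rpow summable_prod_rpow)
open Summit.Parity.GeneralizedHardyLittlewood.Theorems.BeyondDiagonalBeatsQuarter.OffDiag
  (mem_Ioo_of_dyadicBump_div_two_pow_ne_zero dyadicWeight_mem_Icc tsum_dyadicBox_eq_sum
    tsum_eq_tsum_dyadicBoxes summable_dyadicBoxes afeWeight_dilated_eq_zero_of_axis)

variable {q : ℕ} [NeZero q]

/-! ### §1. The layer summand and the far decay of the AFE weight -/

/-- **The summand of a re-indexed layer, bounded by Weil**: for `q` prime, `l, m ≥ 1`, `d₁ ∣ l`, `d₂ ∣ m`,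
`τ(r) ≤ C r^{1/20}` and all `k`, `r`:
`‖w_q(d₁k₁,d₂k₂)·petKloostermanTerm q ((l/d₁)k₁) ((m/d₂)k₂) r‖
  ≤ (lm)^{3/4}·(4πC q^{−1/2} r^{−29/20})·[w_q(n)·(n₁n₂)^{3/4}]`, `n = (d₁k₁, d₂k₂)` (`0 ≤ 0` on the axes).
[cite: KowalskiMichel2000, §2.4.2 p. 312 (23) — derivation] -/
theorem norm_layerSummand_le (hq : q.Prime) {l m : ℕ} (hl : 1 ≤ l) (hm : 1 ≤ m) {d₁ d₂ : ℕ}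
    (hd₁ : d₁ ∈ l.divisors) (hd₂ : d₂ ∈ m.divisors) {C : ℝ}
    (hC : ∀ r : ℕ, ((r.divisors.card : ℕ) : ℝ) ≤ C * (r : ℝ) ^ (1 / 20 : ℝ)) (k : ℕ × ℕ) (r : ℕ) :
    ‖(afeWeight q (d₁ * k.1, d₂ * k.2) : ℂ) * petKloostermanTerm q (l / d₁ * k.1) (m / d₂ * k.2) r‖ ≤
      ((l : ℝ) * m) ^ (3 / 4 : ℝ) * (4 * π * C * (q : ℝ) ^ (-(1 / 2 : ℝ)) * (r : ℝ) ^ (-(29 / 20 : ℝ))) *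
        (afeWeight q (d₁ * k.1, d₂ * k.2) *
          ((((d₁ * k.1 : ℕ) : ℝ)) * ((d₂ * k.2 : ℕ) : ℝ)) ^ (3 / 4 : ℝ)) := by
  have hC0 : 0 ≤ C := by
    have h := hC 1
    simp at h
    linarith
  have hd₁0 : d₁ ≠ 0 := (Nat.pos_of_mem_divisors hd₁).ne'
  have hd₂0 : d₂ ≠ 0 := (Nat.pos_of_mem_divisors hd₂).ne'
  set K : ℝ := 4 * π * C * (q : ℝ) ^ (-(1 / 2 : ℝ)) * (r : ℝ) ^ (-(29 / 20 : ℝ)) with hK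
  have hK0 : 0 ≤ K := by positivity
  rcases Nat.eq_zero_or_pos k.1 with h1 | h1
  · rw [afeWeight_dilated_eq_zero_of_axis q d₁ d₂ (Or.inl h1)]; simp
  rcases Nat.eq_zero_or_pos k.2 with h2 | h2
  · rw [afeWeight_dilated_eq_zero_of_axis q d₁ d₂ (Or.inr h2)]; simp
  -- view the summand as the `(d₁,d₂)`-piece of `offDiagTerm` at `n = (d₁k₁, d₂k₂)`
  set n : ℕ × ℕ := (d₁ * k.1, d₂ * k.2) with hn
  have hn1 : 1 ≤ n.1 := Nat.mul_pos (Nat.pos_of_ne_zero hd₁0) h1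
  have hn2 : 1 ≤ n.2 := Nat.mul_pos (Nat.pos_of_ne_zero hd₂0) h2
  have hd₁' : d₁ ∈ (l.gcd n.1).divisors :=
    Nat.mem_divisors.2 ⟨Nat.dvd_gcd (Nat.dvd_of_mem_divisors hd₁) (Dvd.intro _ rfl),
      Nat.gcd_ne_zero_left (by omega)⟩
  have hd₂' : d₂ ∈ (m.gcd n.2).divisors :=
    Nat.mem_divisors.2 ⟨Nat.dvd_gcd (Nat.dvd_of_mem_divisors hd₂) (Dvd.intro _ rfl),
      Nat.gcd_ne_zero_left (by omega)⟩
  have ha : l / d₁ * k.1 = l * n.1 / d₁ ^ 2 := (mul_mul_div_sq (Nat.dvd_of_mem_divisors hd₁) hd₁0).symm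
  have hb : m / d₂ * k.2 = m * n.2 / d₂ ^ 2 := (mul_mul_div_sq (Nat.dvd_of_mem_divisors hd₂) hd₂0).symm
  have hsplit : (((l : ℝ) * m) * ((n.1 : ℝ) * n.2)) ^ (3 / 4 : ℝ) =
      ((l : ℝ) * m) ^ (3 / 4 : ℝ) * ((n.1 : ℝ) * n.2) ^ (3 / 4 : ℝ) :=
    Real.mul_rpow (by positivity) (by positivity)
  rw [ha, hb]
  calc ‖(afeWeight q n : ℂ) * petKloostermanTerm q (l * n.1 / d₁ ^ 2) (m * n.2 / d₂ ^ 2) r‖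
      ≤ afeWeight q n * (Real.sqrt (((l * n.1 / d₁ ^ 2).gcd (m * n.2 / d₂ ^ 2) : ℕ) : ℝ) *
          Real.sqrt (((l * n.1 / d₁ ^ 2 : ℕ) : ℝ) * ((m * n.2 / d₂ ^ 2 : ℕ) : ℝ))) * K :=
        norm_afeWeight_mul_petKloostermanTerm_le hq hl m hC n hd₁' d₂ r
    _ ≤ afeWeight q n * (((l : ℝ) * m) * ((n.1 : ℝ) * n.2)) ^ (3 / 4 : ℝ) * K :=
        mul_le_mul_of_nonneg_right (mul_le_mul_of_nonneg_left
          (sqrt_gcd_mul_sqrt_le_rpow hl hm hn1 hn2 hd₁' hd₂') (afeWeight_nonneg q n)) hK0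
    _ = _ := by rw [hsplit, hn]; push_cast; ring

omit [NeZero q] in
/-- **Far decay of the AFE weight**: for `q ≥ 1`, `y₀ > 0` and `n₁n₂ ≥ q̂²y₀`,
`w_q(n₁,n₂)·(n₁n₂)^{3/4} ≤ 96·e^{−√y₀/2}·q̂³·n₁^{−5/4}n₂^{−5/4}` (`W(y) ≤ 2·3!·2³e^{−√y₀/2}y^{−3/2}` for `y ≥ y₀`).
[cite: KowalskiMichelVanderKam2000, (22) p. 12 — derivation] -/
theorem afeWeight_mul_rpow_le_far (hq : 1 ≤ q) {y₀ : ℝ} (hy₀ : 0 < y₀) {n : ℕ × ℕ}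
    (hfar : qhat q ^ 2 * y₀ ≤ (n.1 : ℝ) * n.2) :
    afeWeight q n * ((n.1 : ℝ) * n.2) ^ (3 / 4 : ℝ) ≤
      96 * Real.exp (-(Real.sqrt y₀ / 2)) * qhat q ^ 3 * ((n.1 : ℝ) ^ (-(5 / 4 : ℝ)) * (n.2 : ℝ) ^ (-(5 / 4 : ℝ))) := by
  have hQ : 0 < qhat q := qhat_pos hq
  have hx : (0 : ℝ) < (n.1 : ℝ) * n.2 := lt_of_lt_of_le (by positivity) hfar
  have h1 : (0 : ℝ) < n.1 := by
    rcases Nat.eq_zero_or_pos n.1 with h | h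
    · simp [h] at hx
    · exact_mod_cast h
  have h2 : (0 : ℝ) < n.2 := by
    rcases Nat.eq_zero_or_pos n.2 with h | h
    · simp [h] at hx
    · exact_mod_cast h
  set x : ℝ := (n.1 : ℝ) * n.2 with hx_def
  have hy : y₀ ≤ x / qhat q ^ 2 := by rw [le_div_iff₀ (by positivity)]; linarith
  have hy' : 0 < x / qhat q ^ 2 := by positivity
  have hW : cutoffW (x / qhat q ^ 2) ≤ 96 * Real.exp (-(Real.sqrt y₀ / 2)) * (x ^ (-(3 / 2 : ℝ)) * qhat q ^ 3) := by
    have h := cutoffW_le_exp_mul_rpow hy₀ hy 3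
    have hQ3 : (qhat q ^ 2) ^ (-(3 / 2 : ℝ)) = (qhat q ^ 3)⁻¹ := by
      rw [← Real.rpow_natCast (qhat q) 2, ← Real.rpow_mul hQ.le,
        show ((2 : ℕ) : ℝ) * (-(3 / 2 : ℝ)) = -((3 : ℕ) : ℝ) by norm_num, Real.rpow_neg hQ.le,
        Real.rpow_natCast]
    have e : (x / qhat q ^ 2) ^ (-(((3 : ℕ) : ℝ) / 2)) = x ^ (-(3 / 2 : ℝ)) * qhat q ^ 3 := by
      rw [show (-(((3 : ℕ) : ℝ) / 2)) = -(3 / 2 : ℝ) by norm_num, Real.div_rpow hx.le (by positivity), hQ3,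
        div_inv_eq_mul]
    calc cutoffW (x / qhat q ^ 2)
        ≤ 2 * ((3 : ℕ)! : ℝ) * 2 ^ 3 * Real.exp (-(Real.sqrt y₀ / 2)) * (x / qhat q ^ 2) ^ (-(((3 : ℕ) : ℝ) / 2)) := h
      _ = 96 * Real.exp (-(Real.sqrt y₀ / 2)) * (x ^ (-(3 / 2 : ℝ)) * qhat q ^ 3) := by
          rw [e]; norm_num [Nat.factorial]
  have hpow : x ^ (-(1 / 2 : ℝ)) * x ^ (-(3 / 2 : ℝ)) * x ^ (3 / 4 : ℝ) =
      (n.1 : ℝ) ^ (-(5 / 4 : ℝ)) * (n.2 : ℝ) ^ (-(5 / 4 : ℝ)) := by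
    rw [← Real.rpow_add hx, ← Real.rpow_add hx, hx_def, ← Real.mul_rpow h1.le h2.le]
    norm_num
  unfold afeWeight
  rw [← hx_def]
  calc x ^ (-(1 / 2 : ℝ)) * cutoffW (x / qhat q ^ 2) * x ^ (3 / 4 : ℝ)
      ≤ x ^ (-(1 / 2 : ℝ)) * (96 * Real.exp (-(Real.sqrt y₀ / 2)) * (x ^ (-(3 / 2 : ℝ)) * qhat q ^ 3)) *
          x ^ (3 / 4 : ℝ) := by gcongr
    _ = 96 * Real.exp (-(Real.sqrt y₀ / 2)) * qhat q ^ 3 *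
          (x ^ (-(1 / 2 : ℝ)) * x ^ (-(3 / 2 : ℝ)) * x ^ (3 / 4 : ℝ)) := by ring
    _ = _ := by rw [hpow]

/-! ### §2. One dyadic box: card × sup -/

omit [NeZero q] in
/-- Support of the two-dimensional dyadic weight at integer points: `θ(k₁/2^{i₁})θ(k₂/2^{i₂}) ≠ 0` forces
`2^{i_j}/2 < k_j < 2^{i_j+1}`. [folklore] -/
theorem box_support {i k : ℕ × ℕ}
    (h : dyadicBump ((k.1 : ℝ) / 2 ^ i.1) * dyadicBump ((k.2 : ℝ) / 2 ^ i.2) ≠ 0) :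
    ((2 : ℝ) ^ i.1 / 2 < k.1 ∧ (k.1 : ℝ) < 2 ^ (i.1 + 1)) ∧ ((2 : ℝ) ^ i.2 / 2 < k.2 ∧ (k.2 : ℝ) < 2 ^ (i.2 + 1)) :=
  ⟨mem_Ioo_of_dyadicBump_div_two_pow_ne_zero (left_ne_zero_of_mul h),
    mem_Ioo_of_dyadicBump_div_two_pow_ne_zero (right_ne_zero_of_mul h)⟩

omit [NeZero q] in
/-- The per-coordinate factor of «card × sup»: for `d ≥ 1`,
`2^{i+1}·(d·2^i/2)^{−5/4} ≤ 8·d^{−5/4}·ρ^i`, `ρ = 2^{−1/4}` (`2^{5/4} ≤ 4`). [folklore] -/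
theorem coord_factor_le {d : ℕ} (hd : 1 ≤ d) (i : ℕ) :
    (2 : ℝ) ^ (i + 1) * ((d : ℝ) * 2 ^ i / 2) ^ (-(5 / 4 : ℝ)) ≤
      8 * (d : ℝ) ^ (-(5 / 4 : ℝ)) * ((2 : ℝ) ^ (-(1 / 4 : ℝ))) ^ i := by
  have hd0 : (0 : ℝ) < d := by exact_mod_cast hd
  have h2i : (0 : ℝ) < 2 ^ i := by positivity
  -- `(d·2^i/2)^{-5/4} = d^{-5/4} (2^i)^{-5/4} 2^{5/4}`
  have hsplit : ((d : ℝ) * 2 ^ i / 2) ^ (-(5 / 4 : ℝ)) =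
      (d : ℝ) ^ (-(5 / 4 : ℝ)) * ((2 : ℝ) ^ i) ^ (-(5 / 4 : ℝ)) * (2 : ℝ) ^ (5 / 4 : ℝ) := by
    rw [Real.div_rpow (by positivity) (by norm_num), Real.mul_rpow hd0.le h2i.le,
      Real.rpow_neg (by norm_num : (0 : ℝ) ≤ 2), div_inv_eq_mul]
  -- `(2^i)^{-5/4} · 2^i = ρ^i`, `ρ = 2^{-1/4}`
  have hρ : (2 : ℝ) ^ i * ((2 : ℝ) ^ i) ^ (-(5 / 4 : ℝ)) = ((2 : ℝ) ^ (-(1 / 4 : ℝ))) ^ i := by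
    rw [← Real.rpow_natCast (2 : ℝ) i, ← Real.rpow_mul (by norm_num : (0 : ℝ) ≤ 2),
      ← Real.rpow_add (by norm_num : (0 : ℝ) < 2), ← Real.rpow_mul_natCast (by norm_num : (0 : ℝ) ≤ 2)]
    congr 1
    ring
  have h54 : (2 : ℝ) ^ (5 / 4 : ℝ) ≤ 4 := by
    calc (2 : ℝ) ^ (5 / 4 : ℝ) ≤ (2 : ℝ) ^ (2 : ℝ) :=
          Real.rpow_le_rpow_of_exponent_le (by norm_num) (by norm_num)
      _ = 4 := by norm_num
  calc (2 : ℝ) ^ (i + 1) * ((d : ℝ) * 2 ^ i / 2) ^ (-(5 / 4 : ℝ))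
      = 2 * (d : ℝ) ^ (-(5 / 4 : ℝ)) * ((2 : ℝ) ^ i * ((2 : ℝ) ^ i) ^ (-(5 / 4 : ℝ))) * (2 : ℝ) ^ (5 / 4 : ℝ) := by
        rw [hsplit, pow_succ]; ring
    _ = 2 * (d : ℝ) ^ (-(5 / 4 : ℝ)) * ((2 : ℝ) ^ (-(1 / 4 : ℝ))) ^ i * (2 : ℝ) ^ (5 / 4 : ℝ) := by rw [hρ]
    _ ≤ 2 * (d : ℝ) ^ (-(5 / 4 : ℝ)) * ((2 : ℝ) ^ (-(1 / 4 : ℝ))) ^ i * 4 := by gcongr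
    _ = _ := by ring

/-- **One dyadic box, card × sup.** Let `q` be prime, `l, m ≥ 1`, `d₁ ∣ l`, `d₂ ∣ m`, `τ(r) ≤ C r^{1/20}`, `E ≥ 0`,
and suppose the AFE-weight bound `w_q(n)(n₁n₂)^{3/4} ≤ E·q̂³·n₁^{−5/4}n₂^{−5/4}` holds at every `n = (d₁k₁,d₂k₂)`
with `k` in the open box `2^{i_j}/2 < k_j` (`j = 1,2`). Then
`‖Σ_k θ(k₁/2^{i₁})θ(k₂/2^{i₂})·w_q(d₁k₁,d₂k₂)·petKloostermanTerm q ((l/d₁)k₁)((m/d₂)k₂) r‖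
  ≤ 64·(lm)^{3/4}·(4πC q^{−1/2}r^{−29/20})·E q̂³·(d₁d₂)^{−5/4}·ρ^{i₁}ρ^{i₂}`, `ρ = 2^{−1/4}`.
[cite: KowalskiMichel2000, §2.4.2 p. 312 (23); KowalskiMichelVanderKam2000, (22) p. 12 — derivation] -/
theorem norm_boxSum_le (hq : q.Prime) {l m : ℕ} (hl : 1 ≤ l) (hm : 1 ≤ m) {d₁ d₂ : ℕ}
    (hd₁ : d₁ ∈ l.divisors) (hd₂ : d₂ ∈ m.divisors) {C : ℝ}
    (hC : ∀ r : ℕ, ((r.divisors.card : ℕ) : ℝ) ≤ C * (r : ℝ) ^ (1 / 20 : ℝ)) (r : ℕ) (i : ℕ × ℕ) {E : ℝ}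
    (hE0 : 0 ≤ E)
    (hE : ∀ k : ℕ × ℕ, (2 : ℝ) ^ i.1 / 2 < k.1 → (2 : ℝ) ^ i.2 / 2 < k.2 →
      afeWeight q (d₁ * k.1, d₂ * k.2) * ((((d₁ * k.1 : ℕ) : ℝ)) * ((d₂ * k.2 : ℕ) : ℝ)) ^ (3 / 4 : ℝ) ≤
        E * qhat q ^ 3 * ((((d₁ * k.1 : ℕ) : ℝ)) ^ (-(5 / 4 : ℝ)) * (((d₂ * k.2 : ℕ) : ℝ)) ^ (-(5 / 4 : ℝ)))) :
    ‖∑' k : ℕ × ℕ, ((dyadicBump ((k.1 : ℝ) / 2 ^ i.1) * dyadicBump ((k.2 : ℝ) / 2 ^ i.2) : ℝ) : ℂ) *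
        ((afeWeight q (d₁ * k.1, d₂ * k.2) : ℂ) * petKloostermanTerm q (l / d₁ * k.1) (m / d₂ * k.2) r)‖ ≤
      64 * ((l : ℝ) * m) ^ (3 / 4 : ℝ) * (4 * π * C * (q : ℝ) ^ (-(1 / 2 : ℝ)) * (r : ℝ) ^ (-(29 / 20 : ℝ))) *
        (E * qhat q ^ 3) * (((d₁ : ℝ) * d₂) ^ (-(5 / 4 : ℝ))) *
        (((2 : ℝ) ^ (-(1 / 4 : ℝ))) ^ i.1 * ((2 : ℝ) ^ (-(1 / 4 : ℝ))) ^ i.2) := by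
  have hq1 : 1 ≤ q := hq.one_lt.le
  have hQ : 0 < qhat q := qhat_pos hq1
  have hC0 : 0 ≤ C := by
    have h := hC 1
    simp at h
    linarith
  have hd₁1 : 1 ≤ d₁ := Nat.pos_of_mem_divisors hd₁
  have hd₂1 : 1 ≤ d₂ := Nat.pos_of_mem_divisors hd₂
  have hd₁0 : (0 : ℝ) < d₁ := by exact_mod_cast hd₁1
  have hd₂0 : (0 : ℝ) < d₂ := by exact_mod_cast hd₂1
  set K : ℝ := 4 * π * C * (q : ℝ) ^ (-(1 / 2 : ℝ)) * (r : ℝ) ^ (-(29 / 20 : ℝ)) with hK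
  have hK0 : 0 ≤ K := by positivity
  -- the uniform bound on the box
  set B : ℝ := ((l : ℝ) * m) ^ (3 / 4 : ℝ) * K * (E * qhat q ^ 3) *
    ((((d₁ : ℝ) * 2 ^ i.1 / 2) ^ (-(5 / 4 : ℝ))) * (((d₂ : ℝ) * 2 ^ i.2 / 2) ^ (-(5 / 4 : ℝ)))) with hB
  have hB0 : 0 ≤ B := by positivity
  have hterm : ∀ k : ℕ × ℕ,
      ‖((dyadicBump ((k.1 : ℝ) / 2 ^ i.1) * dyadicBump ((k.2 : ℝ) / 2 ^ i.2) : ℝ) : ℂ) *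
        ((afeWeight q (d₁ * k.1, d₂ * k.2) : ℂ) * petKloostermanTerm q (l / d₁ * k.1) (m / d₂ * k.2) r)‖ ≤ B := by
    intro k
    by_cases hθ : dyadicBump ((k.1 : ℝ) / 2 ^ i.1) * dyadicBump ((k.2 : ℝ) / 2 ^ i.2) = 0
    · rw [hθ, Complex.ofReal_zero, zero_mul, norm_zero]; exact hB0
    obtain ⟨⟨hk1, -⟩, ⟨hk2, -⟩⟩ := box_support hθ
    have hθ1 := dyadicWeight_mem_Icc i k
    rw [norm_mul, Complex.norm_real, Real.norm_of_nonneg hθ1.1]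
    have hs := norm_layerSummand_le hq hl hm hd₁ hd₂ hC k r
    rw [← hK] at hs
    -- `n_j^{-5/4} ≤ (d_j 2^{i_j}/2)^{-5/4}`
    have hn1 : (d₁ : ℝ) * 2 ^ i.1 / 2 < ((d₁ * k.1 : ℕ) : ℝ) := by
      push_cast; rw [mul_div_assoc]; exact mul_lt_mul_of_pos_left hk1 hd₁0
    have hn2 : (d₂ : ℝ) * 2 ^ i.2 / 2 < ((d₂ * k.2 : ℕ) : ℝ) := by
      push_cast; rw [mul_div_assoc]; exact mul_lt_mul_of_pos_left hk2 hd₂0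
    have hp1 : (((d₁ * k.1 : ℕ) : ℝ)) ^ (-(5 / 4 : ℝ)) ≤ ((d₁ : ℝ) * 2 ^ i.1 / 2) ^ (-(5 / 4 : ℝ)) :=
      Real.rpow_le_rpow_of_nonpos (by positivity) hn1.le (by norm_num)
    have hp2 : (((d₂ * k.2 : ℕ) : ℝ)) ^ (-(5 / 4 : ℝ)) ≤ ((d₂ : ℝ) * 2 ^ i.2 / 2) ^ (-(5 / 4 : ℝ)) :=
      Real.rpow_le_rpow_of_nonpos (by positivity) hn2.le (by norm_num)
    have hw := hE k hk1 hk2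
    calc dyadicBump ((k.1 : ℝ) / 2 ^ i.1) * dyadicBump ((k.2 : ℝ) / 2 ^ i.2) *
          ‖(afeWeight q (d₁ * k.1, d₂ * k.2) : ℂ) * petKloostermanTerm q (l / d₁ * k.1) (m / d₂ * k.2) r‖
        ≤ 1 * (((l : ℝ) * m) ^ (3 / 4 : ℝ) * K *
            (afeWeight q (d₁ * k.1, d₂ * k.2) * ((((d₁ * k.1 : ℕ) : ℝ)) * ((d₂ * k.2 : ℕ) : ℝ)) ^ (3 / 4 : ℝ))) :=
          mul_le_mul hθ1.2 hs (norm_nonneg _) zero_le_one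
      _ ≤ 1 * (((l : ℝ) * m) ^ (3 / 4 : ℝ) * K *
            (E * qhat q ^ 3 * ((((d₁ * k.1 : ℕ) : ℝ)) ^ (-(5 / 4 : ℝ)) * (((d₂ * k.2 : ℕ) : ℝ)) ^ (-(5 / 4 : ℝ))))) := by
          gcongr
      _ ≤ 1 * (((l : ℝ) * m) ^ (3 / 4 : ℝ) * K *
            (E * qhat q ^ 3 * (((d₁ : ℝ) * 2 ^ i.1 / 2) ^ (-(5 / 4 : ℝ)) *
              ((d₂ : ℝ) * 2 ^ i.2 / 2) ^ (-(5 / 4 : ℝ))))) := by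
          gcongr
      _ = B := by rw [hB]; ring
  -- card × sup
  rw [tsum_dyadicBox_eq_sum]
  have hcard : ((Finset.range (2 ^ (i.1 + 1)) ×ˢ Finset.range (2 ^ (i.2 + 1))).card : ℝ) =
      (2 : ℝ) ^ (i.1 + 1) * 2 ^ (i.2 + 1) := by
    rw [Finset.card_product, Finset.card_range, Finset.card_range]; push_cast; ring
  calc ‖∑ k ∈ Finset.range (2 ^ (i.1 + 1)) ×ˢ Finset.range (2 ^ (i.2 + 1)),
        ((dyadicBump ((k.1 : ℝ) / 2 ^ i.1) * dyadicBump ((k.2 : ℝ) / 2 ^ i.2) : ℝ) : ℂ) *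
          ((afeWeight q (d₁ * k.1, d₂ * k.2) : ℂ) * petKloostermanTerm q (l / d₁ * k.1) (m / d₂ * k.2) r)‖
      ≤ ∑ k ∈ Finset.range (2 ^ (i.1 + 1)) ×ˢ Finset.range (2 ^ (i.2 + 1)), B :=
        (norm_sum_le _ _).trans (Finset.sum_le_sum fun k _ ↦ hterm k)
    _ = (2 : ℝ) ^ (i.1 + 1) * 2 ^ (i.2 + 1) * B := by rw [Finset.sum_const, nsmul_eq_mul, hcard]
    _ = ((l : ℝ) * m) ^ (3 / 4 : ℝ) * K * (E * qhat q ^ 3) *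
          (((2 : ℝ) ^ (i.1 + 1) * ((d₁ : ℝ) * 2 ^ i.1 / 2) ^ (-(5 / 4 : ℝ))) *
            ((2 : ℝ) ^ (i.2 + 1) * ((d₂ : ℝ) * 2 ^ i.2 / 2) ^ (-(5 / 4 : ℝ)))) := by rw [hB]; ring
    _ ≤ ((l : ℝ) * m) ^ (3 / 4 : ℝ) * K * (E * qhat q ^ 3) *
          ((8 * (d₁ : ℝ) ^ (-(5 / 4 : ℝ)) * ((2 : ℝ) ^ (-(1 / 4 : ℝ))) ^ i.1) *
            (8 * (d₂ : ℝ) ^ (-(5 / 4 : ℝ)) * ((2 : ℝ) ^ (-(1 / 4 : ℝ))) ^ i.2)) := by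
        refine mul_le_mul_of_nonneg_left ?_ (by positivity)
        exact mul_le_mul (coord_factor_le hd₁1 i.1) (coord_factor_le hd₂1 i.2) (by positivity) (by positivity)
    _ = _ := by rw [Real.mul_rpow hd₁0.le hd₂0.le]; ring

/-- **Every box** (`E = 12`): `‖box_i‖ ≤ 64·(lm)^{3/4}·4πC q^{−1/2}r^{−29/20}·12q̂³·(d₁d₂)^{−5/4}·ρ^{i₁}ρ^{i₂}`.
[cite: KowalskiMichel2000, §2.4.2 p. 312 (23); KowalskiMichelVanderKam2000, (22) p. 12 — derivation] -/
theorem norm_boxSum_le_near (hq : q.Prime) {l m : ℕ} (hl : 1 ≤ l) (hm : 1 ≤ m) {d₁ d₂ : ℕ}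
    (hd₁ : d₁ ∈ l.divisors) (hd₂ : d₂ ∈ m.divisors) {C : ℝ}
    (hC : ∀ r : ℕ, ((r.divisors.card : ℕ) : ℝ) ≤ C * (r : ℝ) ^ (1 / 20 : ℝ)) (r : ℕ) (i : ℕ × ℕ) :
    ‖∑' k : ℕ × ℕ, ((dyadicBump ((k.1 : ℝ) / 2 ^ i.1) * dyadicBump ((k.2 : ℝ) / 2 ^ i.2) : ℝ) : ℂ) *
        ((afeWeight q (d₁ * k.1, d₂ * k.2) : ℂ) * petKloostermanTerm q (l / d₁ * k.1) (m / d₂ * k.2) r)‖ ≤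
      64 * ((l : ℝ) * m) ^ (3 / 4 : ℝ) * (4 * π * C * (q : ℝ) ^ (-(1 / 2 : ℝ)) * (r : ℝ) ^ (-(29 / 20 : ℝ))) *
        (12 * qhat q ^ 3) * (((d₁ : ℝ) * d₂) ^ (-(5 / 4 : ℝ))) *
        (((2 : ℝ) ^ (-(1 / 4 : ℝ))) ^ i.1 * ((2 : ℝ) ^ (-(1 / 4 : ℝ))) ^ i.2) :=
  norm_boxSum_le hq hl hm hd₁ hd₂ hC r i (by norm_num)
    fun k _ _ ↦ afeWeight_mul_rpow_le hq.one_lt.le (d₁ * k.1, d₂ * k.2)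

/-- **Far boxes** (`E = 96e^{−√y₀/2}`): if `4q̂²y₀ ≤ 2^{i₁+i₂}·d₁d₂` (`y₀ > 0`), every `k` in the open box has
`n₁n₂ = d₁d₂k₁k₂ > q̂²y₀`, so
`‖box_i‖ ≤ 64·(lm)^{3/4}·4πC q^{−1/2}r^{−29/20}·96e^{−√y₀/2}q̂³·(d₁d₂)^{−5/4}·ρ^{i₁}ρ^{i₂}`.
[cite: KowalskiMichel2000, §2.4.2 p. 312 (23); KowalskiMichelVanderKam2000, (22) p. 12 — derivation] -/
theorem norm_boxSum_le_far (hq : q.Prime) {l m : ℕ} (hl : 1 ≤ l) (hm : 1 ≤ m) {d₁ d₂ : ℕ}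
    (hd₁ : d₁ ∈ l.divisors) (hd₂ : d₂ ∈ m.divisors) {C : ℝ}
    (hC : ∀ r : ℕ, ((r.divisors.card : ℕ) : ℝ) ≤ C * (r : ℝ) ^ (1 / 20 : ℝ)) (r : ℕ) (i : ℕ × ℕ)
    {y₀ : ℝ} (hy₀ : 0 < y₀) (hfar : 4 * qhat q ^ 2 * y₀ ≤ 2 ^ (i.1 + i.2) * ((d₁ : ℝ) * d₂)) :
    ‖∑' k : ℕ × ℕ, ((dyadicBump ((k.1 : ℝ) / 2 ^ i.1) * dyadicBump ((k.2 : ℝ) / 2 ^ i.2) : ℝ) : ℂ) *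
        ((afeWeight q (d₁ * k.1, d₂ * k.2) : ℂ) * petKloostermanTerm q (l / d₁ * k.1) (m / d₂ * k.2) r)‖ ≤
      64 * ((l : ℝ) * m) ^ (3 / 4 : ℝ) * (4 * π * C * (q : ℝ) ^ (-(1 / 2 : ℝ)) * (r : ℝ) ^ (-(29 / 20 : ℝ))) *
        (96 * Real.exp (-(Real.sqrt y₀ / 2)) * qhat q ^ 3) * (((d₁ : ℝ) * d₂) ^ (-(5 / 4 : ℝ))) *
        (((2 : ℝ) ^ (-(1 / 4 : ℝ))) ^ i.1 * ((2 : ℝ) ^ (-(1 / 4 : ℝ))) ^ i.2) := by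
  have hd₁0 : (0 : ℝ) < d₁ := by exact_mod_cast Nat.pos_of_mem_divisors hd₁
  have hd₂0 : (0 : ℝ) < d₂ := by exact_mod_cast Nat.pos_of_mem_divisors hd₂
  refine norm_boxSum_le hq hl hm hd₁ hd₂ hC r i (by positivity) fun k hk1 hk2 ↦
    afeWeight_mul_rpow_le_far hq.one_lt.le hy₀ ?_
  -- `q̂² y₀ ≤ n₁ n₂`
  push_cast
  have hk : (2 : ℝ) ^ i.1 / 2 * ((2 : ℝ) ^ i.2 / 2) ≤ (k.1 : ℝ) * k.2 :=
    mul_le_mul hk1.le hk2.le (by positivity) (by positivity)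
  have h4 : (2 : ℝ) ^ (i.1 + i.2) = 4 * ((2 : ℝ) ^ i.1 / 2 * ((2 : ℝ) ^ i.2 / 2)) := by rw [pow_add]; ring
  calc qhat q ^ 2 * y₀ = (4 * qhat q ^ 2 * y₀) / 4 := by ring
    _ ≤ 2 ^ (i.1 + i.2) * ((d₁ : ℝ) * d₂) / 4 := by gcongr
    _ = ((d₁ : ℝ) * d₂) * ((2 : ℝ) ^ i.1 / 2 * ((2 : ℝ) ^ i.2 / 2)) := by rw [h4]; ring
    _ ≤ ((d₁ : ℝ) * d₂) * ((k.1 : ℝ) * k.2) := mul_le_mul_of_nonneg_left hk (by positivity)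
    _ = (d₁ : ℝ) * k.1 * ((d₂ : ℝ) * k.2) := by ring

end Summit.Parity.GeneralizedHardyLittlewood.Theorems.BeyondDiagonalBeatsQuarter.PeterssonSplit
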